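import Literature.MathematicalPhysics.QuantumLattice.GibbsChordSlackRelEntropy
import HarnessLib

/-!
# The canonical free energy per site of the 2D `t–t'` Hubbard model is non-decreasing in `β`:
# `β ↦ p(β; t,t',U; n)/β` is antitone on `(0, ∞)`; transport of pressure floors hot-ward and ceilings cold-ward by β-ratios

Topic `MathematicalPhysics/QuantumLattice` (family `hubbard`; the `T > 0` certificate calculus of
`HubbardTTPrimeThermalPressureLimit.lean`). With `p(β) = pressureTT' β t t' U n` the thermodynamic-limit canonical
`(rectN n L, S^z = 0)` free entropy per site and `f(β) = −p(β)/β` the free energy per site (`U ≥ 0`, `0 ≤ n < 2`):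

* §1 `ThermodynamicLimit.pressureTT'_mul_le_mul_pressureTT'` / `pressureTT'_div_le_pressureTT'_div`:
  for `0 < β₀ ≤ β₁`, `β₀·p(β₁) ≤ β₁·p(β₀)`, i.e. **`p(β₁)/β₁ ≤ p(β₀)/β₀`** — the free energy `f = −p/β` is NON-DECREASING
  in `β` (non-increasing in the temperature: `∂f/∂T = −s ≤ 0`). Proof in the tree's vocabulary, without derivatives: the
  ceiling step of the β-staircase `p(β₁) ≤ p(β₀) − (β₁ − β₀)·e⁻` (`pressureTT'_le_pressureTT'_sub_mul`) fed with the thermal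
  energy floor `e⁻ = −p(β₁)/β₁`, valid for EVERY torus limit of the canonical sector Gibbs states at `β₁` because the entropy
  density it carries is non-negative, `0 ≤ p(β₁) + β₁·e(ω)` (`IsTorusLimitOfMixture.pressureTT'_add_mul_meanEnergy_nonneg`:
  `p(β) ≥ −β·e₀` and `e(ω) ≥ e₀`). The free-energy form `neg_pressureTT'_div_le_neg_pressureTT'_div` is stated too.
* §2 TRANSPORT BY β-RATIOS for certificate NUMBERS (`0 < β₀ ≤ β₁`):
  `pressureTT'_le_div_mul_of_hotCeiling` — a hot ceiling `p(β₀) ≤ P` gives the cold ceiling `p(β₁) ≤ (β₁/β₀)·P`, i.e. every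
  free-energy FLOOR `−P/β₀ ≤ f(β₀)` persists at every colder temperature (`neg_div_le_freeEnergy_of_hotCeiling`);
  `div_mul_le_pressureTT'_of_coldFloor` — a cold floor `W ≤ p(β₁)` gives the hot floor `(β₀/β₁)·W ≤ p(β₀)`, i.e. every
  free-energy CEILING `f(β₁) ≤ −W/β₁` persists at every hotter temperature (`freeEnergy_le_neg_div_of_coldFloor`).
  These complement the two β-staircase steps (which transport with a thermal ENERGY cap/floor as the slope): here the
  slope is the certificate itself divided by its own `β`, so no `T = 0` row enters. For the sr-mbsolver/hubbard-thermal
  brackets at (8, 7/8, 0) the ratio transport of the Markov anchors (`π⁺(2)/2 = 1.111`, `π⁺(3/2)/(3/2) = 1.201`) is today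
  dominated by the ground-state-floor ray (`|e₅₂₉| = 0.8296`); it bites as soon as a ceiling with `P/β₀` below the `T = 0`
  lower row exists, and it is the hypothesis-light (no `T = 0` row) free-energy floor at every `β ≥ β₀`.

Everything is PROVED (pure theorems); no definition, no named fact, no `sorry`.

## Tree / Mathlib search
REUSED: `ThermodynamicLimit.pressureTT'_le_pressureTT'_sub_mul` (`HubbardTTPrimeThermalPressureLimit`),
`InfVolFermionState.IsTorusLimitOfMixture.pressureTT'_add_mul_meanEnergy_nonneg` (`GibbsChordSlackRelEntropy`).
`lean search 'pressureTT._div|antitone.*pressureTT|pressureTT._mul_le_mul'` (2026-08-28): nothing of this shape — the tree has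
convexity in `β`, the two staircase steps, `U`/`t'` monotonicity and Lipschitz bounds, but not the monotonicity of `p/β`.

## References
* D. Ruelle, *Statistical Mechanics: Rigorous Results* (1969), §3.3–§3.4 (thermodynamic functions of quantum lattice
  systems; positivity of the entropy). [cite: Ruelle1969, §3.4]
* R. B. Israel, *Convexity in the Theory of Lattice Gases* (1979), Thm. I.2.4, Lemma II.3.1. [cite: Israel1979, Thm. I.2.4]
* S. J. Gustafson, I. M. Sigal, *Mathematical Concepts of Quantum Mechanics* (2003), §18.3. [cite: GustafsonSigal2003, §18.3]
-/

noncomputable section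

namespace Literature.MathematicalPhysics.QuantumLattice

open Matrix HubbardWave0 Literature.Probability.LatticeModels
open _root_.Filter
open scoped _root_.Topology

namespace ThermodynamicLimit

section Monotone

variable (t t' : ℝ) {U : ℝ} (hU : 0 ≤ U) {n : ℝ} (hn0 : 0 ≤ n) (hn2 : n < 2)
include hU hn0 hn2

/-! ### §1 `p(β)/β` is antitone on `(0, ∞)` (the free energy is non-decreasing in `β`) -/

/-- **`β₀·p(β₁) ≤ β₁·p(β₀)` for `0 < β₀ ≤ β₁`** (`U ≥ 0`, `0 ≤ n < 2`): the cross-multiplied form of the monotonicity of the free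
energy per site. Proof: the β-staircase ceiling step with the floor `−p(β₁)/β₁ ≤ e(ω)` on every torus-limit Gibbs state at `β₁`
(non-negativity of the entropy density `p(β₁) + β₁ e(ω)`). [cite: Ruelle1969, §3.4] [cite: GustafsonSigal2003, §18.3] -/
theorem pressureTT'_mul_le_mul_pressureTT' {β₀ β₁ : ℝ} (hβ₀ : 0 < β₀) (hβ : β₀ ≤ β₁) :
    β₀ * pressureTT' β₁ t t' U n ≤ β₁ * pressureTT' β₀ t t' U n := by
  have hβ₁ : 0 < β₁ := lt_of_lt_of_le hβ₀ hβ
  have hstep := pressureTT'_le_pressureTT'_sub_mul hn0 hn2 t t' hU hβ₀.le hβ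
    (efl := -(pressureTT' β₁ t t' U n) / β₁)
    (fun ω Ls hLs hω => by
      have hs := InfVolFermionState.IsTorusLimitOfMixture.pressureTT'_add_mul_meanEnergy_nonneg hU hn0 hn2 hβ₁ hω hLs
      rw [div_le_iff₀ hβ₁]
      linarith)
  -- `p₁ ≤ p₀ + (β₁ − β₀)·p₁/β₁`; clear the denominator
  have hmul : β₁ * pressureTT' β₁ t t' U n ≤
      β₁ * pressureTT' β₀ t t' U n + (β₁ - β₀) * pressureTT' β₁ t t' U n := by
    have h := mul_le_mul_of_nonneg_left hstep hβ₁.le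
    have hcalc : β₁ * (pressureTT' β₀ t t' U n - (β₁ - β₀) * (-(pressureTT' β₁ t t' U n) / β₁)) =
        β₁ * pressureTT' β₀ t t' U n + (β₁ - β₀) * pressureTT' β₁ t t' U n := by
      field_simp
      ring
    linarith [hcalc]
  linarith

/-- **The free entropy per site over `β` is antitone**: `p(β₁)/β₁ ≤ p(β₀)/β₀` for `0 < β₀ ≤ β₁` (`U ≥ 0`, `0 ≤ n < 2`).
[cite: Ruelle1969, §3.4] [cite: Israel1979, Thm. I.2.4] -/
theorem pressureTT'_div_le_pressureTT'_div {β₀ β₁ : ℝ} (hβ₀ : 0 < β₀) (hβ : β₀ ≤ β₁) :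
    pressureTT' β₁ t t' U n / β₁ ≤ pressureTT' β₀ t t' U n / β₀ := by
  have hβ₁ : 0 < β₁ := lt_of_lt_of_le hβ₀ hβ
  rw [div_le_div_iff₀ hβ₁ hβ₀]
  have h := pressureTT'_mul_le_mul_pressureTT' t t' hU hn0 hn2 hβ₀ hβ
  linarith [mul_comm β₀ (pressureTT' β₁ t t' U n), mul_comm β₁ (pressureTT' β₀ t t' U n)]

/-- **The free energy per site `f(β) = −p(β)/β` is non-decreasing in `β`** (non-increasing in the temperature `T = 1/β`):
`−p(β₀)/β₀ ≤ −p(β₁)/β₁` for `0 < β₀ ≤ β₁`. [cite: Ruelle1969, §3.4] [cite: Israel1979, Thm. I.2.4] -/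
theorem neg_pressureTT'_div_le_neg_pressureTT'_div {β₀ β₁ : ℝ} (hβ₀ : 0 < β₀) (hβ : β₀ ≤ β₁) :
    -(pressureTT' β₀ t t' U n) / β₀ ≤ -(pressureTT' β₁ t t' U n) / β₁ := by
  have h := pressureTT'_div_le_pressureTT'_div t t' hU hn0 hn2 hβ₀ hβ
  rw [neg_div, neg_div]
  exact neg_le_neg h

/-- `β ↦ p(β; t,t',U; n)/β` is `AntitoneOn` the open half-line `(0, ∞)`. [cite: Ruelle1969, §3.4] -/
theorem antitoneOn_pressureTT'_div :
    AntitoneOn (fun β : ℝ => pressureTT' β t t' U n / β) (Set.Ioi 0) :=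
  fun _ hβ₀ _ _ hβ => pressureTT'_div_le_pressureTT'_div t t' hU hn0 hn2 (Set.mem_Ioi.1 hβ₀) hβ

/-! ### §2 Transport of certificate numbers by β-ratios -/

/-- **A hot pressure CEILING is a cold pressure ceiling, scaled**: `p(β₀) ≤ P`, `0 < β₀ ≤ β₁` ⇒ `p(β₁) ≤ (β₁/β₀)·P`.
No `T = 0` row enters (compare the staircase step `pressureTT'_le_pressureTT'_sub_mul`, whose slope is a thermal energy floor).
[cite: Ruelle1969, §3.4] [cite: GustafsonSigal2003, §18.3] -/
theorem pressureTT'_le_div_mul_of_hotCeiling {β₀ β₁ P : ℝ} (hβ₀ : 0 < β₀) (hβ : β₀ ≤ β₁)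
    (hP : pressureTT' β₀ t t' U n ≤ P) : pressureTT' β₁ t t' U n ≤ β₁ / β₀ * P := by
  have hβ₁ : 0 < β₁ := lt_of_lt_of_le hβ₀ hβ
  have h := pressureTT'_div_le_pressureTT'_div t t' hU hn0 hn2 hβ₀ hβ
  have h' : pressureTT' β₁ t t' U n / β₁ ≤ P / β₀ := h.trans (div_le_div_of_nonneg_right hP hβ₀.le)
  rw [div_le_iff₀ hβ₁] at h'
  calc pressureTT' β₁ t t' U n ≤ P / β₀ * β₁ := h'
    _ = β₁ / β₀ * P := by ring

/-- **A cold pressure FLOOR is a hot pressure floor, scaled**: `W ≤ p(β₁)`, `0 < β₀ ≤ β₁` ⇒ `(β₀/β₁)·W ≤ p(β₀)`.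
[cite: Ruelle1969, §3.4] [cite: GustafsonSigal2003, §18.3] -/
theorem div_mul_le_pressureTT'_of_coldFloor {β₀ β₁ W : ℝ} (hβ₀ : 0 < β₀) (hβ : β₀ ≤ β₁)
    (hW : W ≤ pressureTT' β₁ t t' U n) : β₀ / β₁ * W ≤ pressureTT' β₀ t t' U n := by
  have hβ₁ : 0 < β₁ := lt_of_lt_of_le hβ₀ hβ
  have h := pressureTT'_div_le_pressureTT'_div t t' hU hn0 hn2 hβ₀ hβ
  have h' : W / β₁ ≤ pressureTT' β₀ t t' U n / β₀ := (div_le_div_of_nonneg_right hW hβ₁.le).trans h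
  rw [le_div_iff₀ hβ₀] at h'
  calc β₀ / β₁ * W = W / β₁ * β₀ := by ring
    _ ≤ pressureTT' β₀ t t' U n := h'

/-- **Every hot free-energy FLOOR persists cold-ward**: `p(β₀) ≤ P`, `0 < β₀ ≤ β₁` ⇒ `−P/β₀ ≤ −p(β₁)/β₁ = f(β₁)`.
[cite: Ruelle1969, §3.4] [cite: Israel1979, Thm. I.2.4] -/
theorem neg_div_le_freeEnergy_of_hotCeiling {β₀ β₁ P : ℝ} (hβ₀ : 0 < β₀) (hβ : β₀ ≤ β₁)
    (hP : pressureTT' β₀ t t' U n ≤ P) : -P / β₀ ≤ -(pressureTT' β₁ t t' U n) / β₁ := by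
  have hβ₁ : 0 < β₁ := lt_of_lt_of_le hβ₀ hβ
  have h := pressureTT'_le_div_mul_of_hotCeiling t t' hU hn0 hn2 hβ₀ hβ hP
  rw [neg_div, neg_div, neg_le_neg_iff, div_le_div_iff₀ hβ₁ hβ₀]
  calc pressureTT' β₁ t t' U n * β₀ ≤ β₁ / β₀ * P * β₀ := mul_le_mul_of_nonneg_right h hβ₀.le
    _ = P * β₁ := by field_simp

/-- **Every cold free-energy CEILING persists hot-ward**: `W ≤ p(β₁)`, `0 < β₀ ≤ β₁` ⇒ `f(β₀) = −p(β₀)/β₀ ≤ −W/β₁`.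
[cite: Ruelle1969, §3.4] [cite: Israel1979, Thm. I.2.4] -/
theorem freeEnergy_le_neg_div_of_coldFloor {β₀ β₁ W : ℝ} (hβ₀ : 0 < β₀) (hβ : β₀ ≤ β₁)
    (hW : W ≤ pressureTT' β₁ t t' U n) : -(pressureTT' β₀ t t' U n) / β₀ ≤ -W / β₁ := by
  have hβ₁ : 0 < β₁ := lt_of_lt_of_le hβ₀ hβ
  have h := div_mul_le_pressureTT'_of_coldFloor t t' hU hn0 hn2 hβ₀ hβ hW
  rw [neg_div, neg_div, neg_le_neg_iff, div_le_div_iff₀ hβ₁ hβ₀]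
  calc W * β₀ = β₀ / β₁ * W * β₁ := by field_simp
    _ ≤ pressureTT' β₀ t t' U n * β₁ := mul_le_mul_of_nonneg_right h hβ₁.le

/-- **Two-sided form**: brackets `W₁ ≤ p(β₁)` at the cold end and `p(β₀) ≤ P₀` at the hot end of `0 < β₀ ≤ β₁` give, at EVERY
intermediate `β ∈ [β₀, β₁]`, the free-energy window `−P₀/β₀ ≤ f(β) ≤ −W₁/β₁` — a temperature-RANGE cell from two point certificates,
with no energy input. [cite: Ruelle1969, §3.4] [cite: Israel1979, Thm. I.2.4] -/
theorem freeEnergy_mem_Icc_of_hotCeiling_of_coldFloor {β₀ β₁ β P₀ W₁ : ℝ} (hβ₀ : 0 < β₀) (h₀ : β₀ ≤ β) (h₁ : β ≤ β₁)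
    (hP : pressureTT' β₀ t t' U n ≤ P₀) (hW : W₁ ≤ pressureTT' β₁ t t' U n) :
    -(pressureTT' β t t' U n) / β ∈ Set.Icc (-P₀ / β₀) (-W₁ / β₁) :=
  ⟨neg_div_le_freeEnergy_of_hotCeiling t t' hU hn0 hn2 hβ₀ h₀ hP,
    freeEnergy_le_neg_div_of_coldFloor t t' hU hn0 hn2 (lt_of_lt_of_le hβ₀ h₀) h₁ hW⟩

end Monotone

end ThermodynamicLimit

end Literature.MathematicalPhysics.QuantumLattice

end
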